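import Literature.NumberTheory.Transcendental.DiazMainProofs
import Literature.NumberTheory.Transcendental.DiazGridXYProofs
import HarnessLib

/-!
# Laurent's transcription of Diaz 1989, assertion iii): the range of bound `2`, and what is left

Topic `Literature/NumberTheory/Transcendental`. Second proof companion (after the shared
`DiazMainProofs.lean`) for the named fact
`Literature.NumberTheory.Transcendental.Diaz1989_main_iii` (`DiazMain.lean`; M. Laurent,
*Sur quelques résultats récents de transcendance*, Journées Arithmétiques de Luminy 1989,
Astérisque 198–200 (1991), §3.1, Théorème 3 iii), p. 213, "extrait de [9]" = G. Diaz,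
J. Number Theory 31 (1989)): for `ℚ`-linearly independent `x₁, …, x_m` and `y₁, …, y_n`
(`m, n ≥ 1`) with `log|∑ λᵢxᵢ| ≫ -max|λᵢ|` and `log|∑ μⱼyⱼ| ≫ -(max|μⱼ|)^{η₃}`,
`η₃ = (mn+m+n-1)/(2m+n)`, one has `t₃ = trdeg_ℚ ℚ(xᵢ, yⱼ, e^{xᵢyⱼ}) ≥ mn/(m+n)`, encoded
`⌈mn/(m+n)⌉ ≤ t₃`.

`DiazMainProofs.lean` proves the assertion in the range `mn ≤ m + n` (bound `1`,
Hermite–Lindemann) and reduces the fact to `m + n < mn` (`Diaz1989_main_iii_of_add_lt_mul`).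
Here, with no measure of linear independence at all:

* `DiazMain.natCeil_eq_two`, `DiazMain.three_le_natCeil`, `DiazMain.three_le_of_largeRange`,
  `DiazMain.largeRange_iff` — arithmetic of the printed bound: for `m + n < mn ≤ 2(m+n)` it is
  `⌈mn/(m+n)⌉ = 2`; for `2(m+n) < mn` it is `≥ 3`, and that "large range" is exactly
  `m ≥ 3, n ≥ 7`, or `m ≥ 4, n ≥ 5`, or `m ≥ 5, n ≥ 4`, or `m ≥ 7, n ≥ 3` (so `m, n ≥ 3`).
* `Diaz1989_main_iii.two_le_trdeg` — **`t₃ ≥ 2` whenever `m + n < mn`, for `ℚ`-linearly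
  independent `x`, `y` and nothing else**: this is the small-transcendence-degree theorem
  LNM 1752, Ch. 13, Theorem 3.1 (iv) (Brownawell 1974 / Waldschmidt 1973: `mn ≥ m + n + 1 ⇒
  trdeg_ℚ ℚ(xᵢ, yⱼ, e^{xᵢyⱼ}) ≥ 2`), which the tree PROVES (`Laurent2001_thm_3_1_iv_holds`,
  `ExpSmallTrdegProofsIV.lean`: Gel'fond's method with Tijdeman's zero estimate and Gel'fond's
  criterion); the field `gridField₂ x y` there is definitionally the field of the fact. This is
  Laurent's Remarque 3 (loc. cit., p. 214) in transcendence degree `1`: "Il en est notamment ainsi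
  en degré de transcendance 0 ou 1 (i.e. `t_k ≥ 1` ou `2`)" — no measure is needed.
* `Diaz1989_main_iii_midRange`, `Diaz1989_main_iii_smallRange` — hence **assertion iii) HOLDS
  outright whenever `mn ≤ 2(m+n)`** (`m = 1, 2` or `n = 1, 2`, and
  `(m, n) ∈ {(3,3), …, (3,6), (4,3), (4,4), (5,3), (6,3)}`), with the printed hypotheses, of which
  only the linear independence is used.
* `Diaz1989_main_iii_of_largeRange`, `Diaz1989_main_iii_of_largeRange'` — so **the fact reduces
  to its large range `2(m+n) < mn`** (bound `⌈mn/(m+n)⌉ ≥ 3`, `m, n ≥ 3`).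

What is NOT here: the discharge `Diaz1989_main_iii_holds`. In the large range the assertion is a
statement of LARGE transcendence degree (`t₃ ≥ 3`) under FIXED-exponent measures of linear
independence. Its only route in print is Gel'fond's method with multiplicities on `𝔾ₐ × 𝔾ₘ^m`
closed by Philippon's criterion for algebraic independence — Philippon 1986, Théorème 2.12 (i)
(Publ. Math. IHÉS 64, p. 40, stated under the Technical Hypothesis, proof "un exercice" on top of
[P1]), Diaz 1989, p. 2 ("permet aussi de retrouver"), transcribed with the exponent `η₃` by
Laurent — and it rests on two deep inputs that the tree vendors as named facts NOT yet discharged: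
`Philippon1986_mainCriterion` (`PhilipponCriterion.lean`, IHÉS 64, Thm 2.11) and the zero
estimate with multiplicities `Philippon1986_GaGm` (`PhilipponZeroEstimate.lean`, Bull. SMF 114,
Thm 2.1). The tree's proved reductions of the sister assertions (`Diaz1989_thm1_of_criterion`,
`Diaz1989_main_ii_of_criterion`: Gel'fond's method WITHOUT multiplicities, some 5 000 lines after
Diaz, §II) do not give iii): for `mn = q(m+n) + r` with `0 < r < min(m, n)` (e.g. `(m, n) = (4, 5)`)
the bounds `[(mn+m)/(m+n)] = [(mn+n)/(m+n)] = q` of i)/ii) fall short of `⌈mn/(m+n)⌉ = q + 1`,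
and the measure on the `yⱼ` in iii) (exponent `η₃ ≥ η₂`) is weaker than in ii). Nothing unproved
is introduced here.

## References

* M. Laurent, *Sur quelques résultats récents de transcendance*, Journées Arithmétiques de Luminy
  1989, Astérisque 198–200 (1991), 209–230, §3.1, Théorème 3 iii) and Remarque 2 (p. 213),
  Remarque 3 (p. 214) (Numdam `AST_1991__198-199-200__209_0`, PDF pp. 6–7). [Laurent1991]
* Yu. V. Nesterenko, P. Philippon (eds.), *Introduction to Algebraic Independence Theory*,
  LNM 1752, Springer 2001, Ch. 13 (M. Laurent), Theorem 3.1 (iv), PDF p. 233; Ch. 14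
  (M. Waldschmidt), Theorem 2.7, Theorem 2.9 and §2.3, PDF pp. 248–250. [NesterenkoPhilippon2001]
* G. Diaz, *Grands degrés de transcendance pour des familles d'exponentielles*, J. Number Theory
  31 (1989), 1–23, p. 2. [Diaz1989]
* P. Philippon, *Critères pour l'indépendance algébrique*, Publ. Math. IHÉS 64 (1986), 5–52,
  Théorème 2.11, Théorème 2.12 (i), pp. 39–40. [Philippon1986Criteres]
-/

noncomputable section

open Finset IntermediateField Complex

namespace Literature.NumberTheory.Transcendental

/-! ### Arithmetic of the printed bound -/

/-- In the range `m + n < mn ≤ 2(m+n)` the printed bound is `⌈mn/(m+n)⌉ = 2`. [folklore] -/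
theorem DiazMain.natCeil_eq_two {m n : ℕ} (h1 : m + n < m * n) (h2 : m * n ≤ 2 * (m + n)) :
    ⌈(m * n : ℚ) / (m + n)⌉₊ = 2 := by
  have e : ((m : ℚ) + n) = n + m := add_comm _ _
  rw [e]
  exact DiazGrid.natCeil_eq_two (d := m) (l := n) (by omega) (by omega)

/-- In the large range `2(m+n) < mn` the printed bound is `⌈mn/(m+n)⌉ ≥ 3`. [folklore] -/
theorem DiazMain.three_le_natCeil {m n : ℕ} (h : 2 * (m + n) < m * n) :
    3 ≤ ⌈(m * n : ℚ) / (m + n)⌉₊ := by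
  have e : ((m : ℚ) + n) = n + m := add_comm _ _
  rw [e]
  exact DiazGrid.three_le_natCeil (d := m) (l := n) (by omega)

/-- The large range forces `m, n ≥ 3`. [folklore] -/
theorem DiazMain.three_le_of_largeRange {m n : ℕ} (h : 2 * (m + n) < m * n) : 3 ≤ m ∧ 3 ≤ n := by
  constructor
  · by_contra hm
    have hm' : m ≤ 2 := by omega
    interval_cases m <;> omega
  · by_contra hn
    have hn' : n ≤ 2 := by omega
    interval_cases n <;> omega

/-- **The large range, listed**: `2(m+n) < mn` (equivalently `(m-2)(n-2) > 4`) holds exactly for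
`m ≥ 3, n ≥ 7`, or `m ≥ 4, n ≥ 5`, or `m ≥ 5, n ≥ 4`, or `m ≥ 7, n ≥ 3`. [folklore] -/
theorem DiazMain.largeRange_iff {m n : ℕ} :
    2 * (m + n) < m * n ↔
      (3 ≤ m ∧ 7 ≤ n) ∨ (4 ≤ m ∧ 5 ≤ n) ∨ (5 ≤ m ∧ 4 ≤ n) ∨ (7 ≤ m ∧ 3 ≤ n) := by
  constructor
  · intro h
    obtain ⟨hm, hn⟩ := DiazMain.three_le_of_largeRange h
    rcases Nat.lt_or_ge m 7 with hm7 | hm7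
    · rcases Nat.lt_or_ge n 7 with hn7 | hn7
      · interval_cases m <;> interval_cases n <;> omega
      · exact Or.inl ⟨hm, hn7⟩
    · exact Or.inr (Or.inr (Or.inr ⟨hm7, hn⟩))
  · rintro (⟨hm, hn⟩ | ⟨hm, hn⟩ | ⟨hm, hn⟩ | ⟨hm, hn⟩) <;> nlinarith

/-! ### `t₃ ≥ 2` for `m + n < mn`, with no measure of linear independence -/

/-- **`trdeg_ℚ ℚ(xᵢ, yⱼ, e^{xᵢyⱼ}) ≥ 2` whenever `m + n < mn`**, for `ℚ`-linearly independent
`x₁, …, x_m` and `y₁, …, y_n`, WITHOUT any measure of linear independence: LNM 1752, Ch. 13,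
Theorem 3.1 (iv) (`mn ≥ m + n + 1 ⇒ t₃ ≥ 2`, Brownawell 1974 / Waldschmidt 1973), proved in the
tree as `Laurent2001_thm_3_1_iv_holds` for the field `gridField₂ x y`, which is by definition the
field `ℚ(range x ∪ range y ∪ range (e^{xᵢyⱼ}))` of the fact. (`m + n < mn` forces `m, n ≥ 1`.)
This is Laurent's Remarque 3 in transcendence degree `1`.
[cite: NesterenkoPhilippon2001, Ch. 13 Theorem 3.1 (iv), PDF p. 233]
[cite: Laurent1991, §3.1 Remarque 3, p. 214] -/
theorem Diaz1989_main_iii.two_le_trdeg {m n : ℕ} (x : Fin m → ℂ) (y : Fin n → ℂ)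
    (hx : LinearIndependent ℚ x) (hy : LinearIndependent ℚ y) (h : m + n < m * n) :
    (2 : Cardinal) ≤ Algebra.trdeg ℚ
      ↥(IntermediateField.adjoin ℚ (Set.range x ∪ Set.range y ∪
        Set.range fun p : Fin m × Fin n => cexp (x p.1 * y p.2))) := by
  obtain ⟨hm3, hn3⟩ : 1 ≤ m ∧ 1 ≤ n := by
    constructor
    · rcases Nat.eq_zero_or_pos m with rfl | hm
      · simp at h
      · exact hm
    · rcases Nat.eq_zero_or_pos n with rfl | hn
      · simp at h
      · exact hn
  exact Laurent2001_thm_3_1_iv_holds m n x y hm3 hn3 hx hy (by omega)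

/-- **Laurent 1991, Théorème 3 iii) in the range `m + n < mn ≤ 2(m+n)`**: there the printed
bound is `⌈mn/(m+n)⌉ = 2` (`DiazMain.natCeil_eq_two`) and `t₃ ≥ 2` is
`Diaz1989_main_iii.two_le_trdeg`; no measure of linear independence is used.
[cite: Laurent1991, §3.1 Théorème 3 iii), p. 213 (range m+n < mn ≤ 2(m+n), via LNM 1752 Ch. 13 Thm 3.1 (iv))] -/
theorem Diaz1989_main_iii_midRange (m n : ℕ) (x : Fin m → ℂ) (y : Fin n → ℂ)
    (hx : LinearIndependent ℚ x) (hy : LinearIndependent ℚ y)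
    (h1 : m + n < m * n) (h2 : m * n ≤ 2 * (m + n)) :
    ((⌈(m * n : ℚ) / (m + n)⌉₊ : ℕ) : Cardinal) ≤ Algebra.trdeg ℚ
      ↥(IntermediateField.adjoin ℚ (Set.range x ∪ Set.range y ∪
        Set.range fun p : Fin m × Fin n => cexp (x p.1 * y p.2))) := by
  rw [DiazMain.natCeil_eq_two h1 h2, Nat.cast_ofNat]
  exact Diaz1989_main_iii.two_le_trdeg x y hx hy h1

/-- **Laurent 1991, Théorème 3 iii) in the whole range `mn ≤ 2(m+n)`, PROVED** (bound `1` by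
Hermite–Lindemann, `Diaz1989_main_iii_of_mul_le_add`; bound `2` by `Diaz1989_main_iii_midRange`),
with the printed hypotheses — the measures of linear independence are not used. This covers
`m ≤ 2` or `n ≤ 2` (all `n`, resp. `m`) and `(m, n) ∈ {(3,3), (3,4), (3,5), (3,6), (4,3), (4,4),
(5,3), (6,3)}`.
[cite: Laurent1991, §3.1 Théorème 3 iii), p. 213 (range mn ≤ 2(m+n))] -/
theorem Diaz1989_main_iii_smallRange (m n : ℕ) (x : Fin m → ℂ) (y : Fin n → ℂ)
    (hx : LinearIndependent ℚ x) (hy : LinearIndependent ℚ y)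
    (hxm : LinIndepMeasure x 1)
    (hym : LinIndepMeasure y ((m * n + m + n - 1 : ℝ) / (2 * m + n)))
    (hm : 1 ≤ m) (hn : 1 ≤ n) (h2 : m * n ≤ 2 * (m + n)) :
    ((⌈(m * n : ℚ) / (m + n)⌉₊ : ℕ) : Cardinal) ≤ Algebra.trdeg ℚ
      ↥(IntermediateField.adjoin ℚ (Set.range x ∪ Set.range y ∪
        Set.range fun p : Fin m × Fin n => cexp (x p.1 * y p.2))) := by
  rcases Nat.lt_or_ge (m + n) (m * n) with hlt | hle
  · exact Diaz1989_main_iii_midRange m n x y hx hy hlt h2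
  · exact Diaz1989_main_iii_of_mul_le_add m n x y hx hy hxm hym hm hn hle

/-! ### Reduction of the fact to the large range `2(m+n) < mn` -/

/-- **Reduction of `Diaz1989_main_iii` to its large range**: assertion iii) follows from its
restriction to `2(m+n) < mn` (bound `⌈mn/(m+n)⌉ ≥ 3`, `m, n ≥ 3`), the complementary range being
`Diaz1989_main_iii_smallRange`. [folklore] -/
theorem Diaz1989_main_iii_of_largeRange
    (h : ∀ (m n : ℕ) (x : Fin m → ℂ) (y : Fin n → ℂ),
      LinearIndependent ℚ x → LinearIndependent ℚ y →
      LinIndepMeasure x 1 →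
      LinIndepMeasure y ((m * n + m + n - 1 : ℝ) / (2 * m + n)) →
      2 * (m + n) < m * n →
        ((⌈(m * n : ℚ) / (m + n)⌉₊ : ℕ) : Cardinal) ≤ Algebra.trdeg ℚ
          ↥(IntermediateField.adjoin ℚ (Set.range x ∪ Set.range y ∪
            Set.range fun p : Fin m × Fin n => cexp (x p.1 * y p.2)))) :
    Diaz1989_main_iii := by
  intro m n x y hx hy hxm hym hm hn
  rcases Nat.lt_or_ge (2 * (m + n)) (m * n) with hlt | hle
  · exact h m n x y hx hy hxm hym hlt
  · exact Diaz1989_main_iii_smallRange m n x y hx hy hxm hym hm hn hle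

/-- The same reduction with the consequences `m, n ≥ 3` and `⌈mn/(m+n)⌉ ≥ 3` of the large range
supplied to the hypothesis (the shape in which a proof by Philippon's criterion — `k + 1 =
⌈mn/(m+n)⌉ ≥ 3` algebraically independent polynomial families — would be assembled).
[folklore] -/
theorem Diaz1989_main_iii_of_largeRange'
    (h : ∀ (m n : ℕ) (x : Fin m → ℂ) (y : Fin n → ℂ),
      LinearIndependent ℚ x → LinearIndependent ℚ y →
      LinIndepMeasure x 1 →
      LinIndepMeasure y ((m * n + m + n - 1 : ℝ) / (2 * m + n)) →
      3 ≤ m → 3 ≤ n → 2 * (m + n) < m * n → 3 ≤ ⌈(m * n : ℚ) / (m + n)⌉₊ →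
        ((⌈(m * n : ℚ) / (m + n)⌉₊ : ℕ) : Cardinal) ≤ Algebra.trdeg ℚ
          ↥(IntermediateField.adjoin ℚ (Set.range x ∪ Set.range y ∪
            Set.range fun p : Fin m × Fin n => cexp (x p.1 * y p.2)))) :
    Diaz1989_main_iii := by
  refine Diaz1989_main_iii_of_largeRange fun m n x y hx hy hxm hym hlt => ?_
  obtain ⟨hm, hn⟩ := DiazMain.three_le_of_largeRange hlt
  exact h m n x y hx hy hxm hym hm hn hlt (DiazMain.three_le_natCeil hlt)

end Literature.NumberTheory.Transcendental

end
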